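import Literature.NumberTheory.EllipticCurves.PrimeConductorTwoTorsionNormalFormProofs
import Literature.NumberTheory.EllipticCurves.ModularCurveManinSemistableCoprimeFormProofs
import Summits.BirchSwinnertonDyer.BirchSwinnertonDyer.Theorems.EisensteinDepletionAtTwoStarGO2PrimeSqDiophantine
import Mathlib.NumberTheory.Padics.PadicVal.Basic
import HarnessLib

/-!
# The prime-square edge of crux `StarGO2` (item stmt-BirchSwinnertonDyer-24444): an elliptic curve over `ℚ`
# of conductor `p²`, `p ≡ ±3 (mod 8)`, has no ÉTALE rational point of order `2`

Line `star` (crux E1M `DepletedLambdaLawAtTwoMod`, stmt-BirchSwinnertonDyer-20341; lead bsd-rank2-star-p1) is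
down to its two research children `StarOptB` (24445) and `StarGO2` (24444, «generalized Ogg at the prime 2»,
lines `parities` / `ubd`). Planner bsd-rank2-p2 GEN 29 (memo `HOME/p2/g29/GO2-via-UBD.md` §8–8a, ray law
(RL0), kit j301225; scratch statement `HOME/p2/g29/PrimeSq.lean`) showed that at conductor `N = p²` with
`p ≡ ±3 (mod 8)` the unique admissible (depleted) Eisenstein ray is RAMIFIED at the denominator-`p` cusps, so
the parity law of `StarGO2` is unsatisfiable there and `StarGO2` restricted to these conductors IS the
statement proved here:

* `star_primeSqEtaleTwoTorsion` — for `W/ℚ` globally minimal of conductor `p²` with `p % 8 ∈ {3, 5}`, every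
  rational `2`-torsion abscissa `x₀` (`HasRationalTwoTorsionX W x₀`) is ramified at `2`
  (`TwoTorsionRamifiedAtTwo x₀`, i.e. `v₂(x₀) < 0`: the point lies in the kernel of reduction mod `2`).
* `star_primeSq_classify` — the underlying classification: an ÉTALE rational `2`-torsion point at conductor
  `p²` (`p` odd) forces `p = 7`, `p = 17` or `p ≡ 1 (mod 8)` (conductors `49`, `289`, `(a² + 64)²`).

## Proof

§1 (`PrimeSq.localData_of_conductorNorm_eq_sq`): conductor `p²` means `f_p = 2` and `f_q = 0` for `q ≠ p`
(`factorization_conductorNorm_primesEquiv_symm`), so the integral globally minimal model `W₀` has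
`Δ(W₀) = ±pᵏ`, `k ≥ 1` (`conductorExponent_ne_zero_of_dvd_Δ`, `pow_conductorExponent_dvd_Δ`) and — the
reduction at `p` being additive, not multiplicative (`conductorExponent_eq_one_iff_holds`,
`hasMultiplicativeReductionAt_iff_of_isMinimalAt`) — `p ∣ c₄(W₀)`. §2: the `2`-torsion normal form of
`Literature/NumberTheory/EllipticCurves/PrimeConductorTwoTorsionNormalFormProofs.lean` (Setzer / Ivorra):
`ξ = 4x₀ ∈ ℤ`, `A = b₂ + 3ξ`, `B = 3ξ² + 2b₂ξ + 8b₄`, `B²(A² − 4B) = 2⁸Δ(W₀)`, `A² − 3B = c₄(W₀)`; `p` odd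
makes `Δ` odd, so `a₁` is odd (`no_root_of_even_a₁_odd_a₃` excludes the supersingular case) and either `ξ`
is odd — then `v₂(x₀) = v₂(ξ/4) = −2 < 0`, the claim — or `4 ∣ ξ` (type I: `A ≡ 1 (mod 4)`, `8 ∣ B`), which
`PrimeSq.typeI_classify` / `PrimeSq.typeI_false`
(`Theorems/EisensteinDepletionAtTwoStarGO2PrimeSqDiophantine.lean`) turn into `p ∈ {7, 17} ∨ p ≡ 1 (mod 8)`.

HONEST FRAMING: a kernel lemma closing ONE edge (conductor `p²`, `p ≡ ±3 (8)`) of the OPEN crux `StarGO2`;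
`StarGO2`, `StarOptB`, E1M are NOT proved; nothing reads an analytic rank; BSD is not proved by any of this.

References: [Setzer1975] B. Setzer, *Elliptic curves of prime conductor*, J. London Math. Soc. (2) 10
(1975) 367–378, §2; [Ivorra2004] W. Ivorra, Dissertationes Math. 429 (2004), §2.1 (the 2-adic
normalisation, types I/II); [SilvermanAEC2009] J. H. Silverman, *The Arithmetic of Elliptic Curves*, 2nd
ed., VII.5.1 (reduction types via `v(Δ)`, `v(c₄)`), VIII.8 (global minimal models), IV.10 of ATAEC
(conductor exponents).
-/

set_option linter.dupNamespace false
set_option autoImplicit false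

namespace Summit.BirchSwinnertonDyer.BirchSwinnertonDyer.Theorems.DepletionAtTwo

open WeierstrassCurve IsDedekindDomain Rat.HeightOneSpectrum
open Literature.NumberTheory.EllipticCurves Literature.NumberTheory.EllipticCurves.Greenberg1999
open Literature.NumberTheory.EllipticCurves.PrimeConductorTwoTorsion

namespace PrimeSq

/-! ## §1 Conductor `p²`: `Δ_min = ±pᵏ` (`k ≥ 1`) and `p ∣ c₄` -/

/-- **Conductor `p²` ⟹ `Δ_min = ±pᵏ`, `k ≥ 1`, `p ∣ c₄`.** For an integral equation `W₀` over `ℤ`,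
minimal at every prime, whose curve has conductor `p²` (`p` prime): the discriminant is `±pᵏ` with `k ≥ 1`
(good reduction away from `p`, bad at `p`) and `p ∣ c₄(W₀)` (the reduction at `p` is not multiplicative,
since `f_p = 2 ≠ 1`). [cite: SilvermanAEC2009, VII.5 Prop. 5.1 and VIII.11; ATAEC IV.10.2] -/
theorem localData_of_conductorNorm_eq_sq (W₀ : WeierstrassCurve ℤ) [(W₀.baseChange ℚ).IsElliptic]
    (hmin : ∀ v : HeightOneSpectrum ℤ, (W₀.baseChange ℚ).IsMinimalAt v) {p : ℕ} (hp : p.Prime)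
    (hN : (W₀.baseChange ℚ).conductorNorm ℤ = p ^ 2) :
    ∃ k : ℕ, 1 ≤ k ∧ (W₀.Δ = (p : ℤ) ^ k ∨ W₀.Δ = -((p : ℤ) ^ k)) ∧ (p : ℤ) ∣ W₀.c₄ := by
  -- adapted from `PrimeConductorTwoTorsion.exists_intModel_of_prime_conductorNorm` (conductor `p`)
  -- the conductor exponents: `f_q = 2` at `q = p`, `0` elsewhere
  have hf : ∀ q : Nat.Primes,
      (W₀.baseChange ℚ).conductorExponent ((primesEquiv (R := ℤ)).symm q) =
        if (q : ℕ) = p then 2 else 0 := by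
    intro q
    rw [← factorization_conductorNorm_primesEquiv_symm, hN, Nat.Prime.factorization_pow hp,
      Finsupp.single_apply]
    by_cases h : (q : ℕ) = p
    · simp [h]
    · simp [h, Ne.symm h]
  -- every prime divisor of `Δ(W₀)` is `p`
  have hΔ0 : W₀.Δ ≠ 0 := Δ_ne_zero_of_isElliptic_baseChange_int W₀
  have hprime_dvd : ∀ q : ℕ, q.Prime → (q : ℤ) ∣ W₀.Δ → q = p := by
    intro q hq hqd
    have hne := conductorExponent_ne_zero_of_dvd_Δ (hmin ((primesEquiv (R := ℤ)).symm ⟨q, hq⟩))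
      (by rw [Literature.NumberTheory.EllipticCurves.Rat.natGenerator_primesEquiv_symm]; exact hqd)
    rw [hf ⟨q, hq⟩] at hne
    by_contra h
    exact hne (by simp [h])
  set k := W₀.Δ.natAbs.factorization p
  have hnat : W₀.Δ.natAbs = p ^ k := by
    refine Nat.eq_pow_of_factorization_eq_single (Int.natAbs_ne_zero.mpr hΔ0)
      (Finsupp.support_subset_singleton.mp ?_)
    intro q hq
    rw [Nat.support_factorization, Nat.mem_primeFactors] at hq
    rw [Finset.mem_singleton]
    exact hprime_dvd q hq.1 (Int.natCast_dvd.mpr (by simpa using hq.2.1))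
  have hΔ : W₀.Δ = (p : ℤ) ^ k ∨ W₀.Δ = -((p : ℤ) ^ k) := by
    rcases Int.natAbs_eq W₀.Δ with h | h
    · left; rw [h, hnat]; push_cast; ring
    · right; rw [h, hnat]; push_cast; ring
  -- `f_p = 2`: `p ∣ Δ` and `p ∣ c₄`
  set v : HeightOneSpectrum ℤ := (primesEquiv (R := ℤ)).symm ⟨p, hp⟩ with hvdef
  have hvN : natGenerator v = p :=
    Literature.NumberTheory.EllipticCurves.Rat.natGenerator_primesEquiv_symm ⟨p, hp⟩
  have hf2 : (W₀.baseChange ℚ).conductorExponent v = 2 := by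
    rw [hvdef, hf ⟨p, hp⟩]; simp
  have hpd : (p : ℤ) ∣ W₀.Δ := by
    have := pow_conductorExponent_dvd_Δ (hmin v)
    rw [hvN, hf2] at this
    exact (dvd_pow_self (p : ℤ) two_ne_zero).trans this
  have hk1 : 1 ≤ k := by
    by_contra h0
    have h0' : k = 0 := by omega
    rw [h0', pow_zero] at hnat
    have h1 : (p : ℤ) ∣ 1 := by
      have := Int.natAbs_dvd_natAbs.mpr hpd
      rw [hnat] at this
      exact_mod_cast this
    have := Int.eq_one_of_dvd_one (by exact_mod_cast p.zero_le) h1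
    have hp1 : p = 1 := by exact_mod_cast this
    exact hp.one_lt.ne' hp1
  have hc4 : (p : ℤ) ∣ W₀.c₄ := by
    by_contra hc4
    have hΔv : v.valuation ℚ (W₀.baseChange ℚ).Δ < 1 := by
      rw [baseChange_int_Δ, Literature.NumberTheory.EllipticCurves.Rat.valuation_intCast_lt_one_iff, hvN]
      exact hpd
    have hc4v : v.valuation ℚ (W₀.baseChange ℚ).c₄ = 1 := by
      rw [baseChange_int_c₄, Literature.NumberTheory.EllipticCurves.Rat.valuation_intCast_eq_one_iff, hvN]
      exact hc4
    have hmult : (W₀.baseChange ℚ).HasMultiplicativeReductionAt v :=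
      (hasMultiplicativeReductionAt_iff_of_isMinimalAt (hmin v)).mpr ⟨hΔv, hc4v⟩
    have hf1 : (W₀.baseChange ℚ).conductorExponent v = 1 :=
      (conductorExponent_eq_one_iff_holds v (W₀.baseChange ℚ)).mpr hmult
    omega
  exact ⟨k, hk1, hΔ, hc4⟩

/-! ## §2 The normal form at conductor `p²` and the `2`-adic position of the point -/

/-- **Conductor `p²`, `p` odd, rational `2`-torsion: ramified at `2`, or type I with `p ∣ c₄`.** For `W/ℚ`
globally minimal of conductor `p²` (`p` an odd prime) and a rational `2`-torsion abscissa `x₀`: either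
`v₂(x₀) < 0`, or there are integers `A ≡ 1 (mod 4)`, `B ≡ 0 (mod 8)` and `k ≥ 1` with
`B²(A² − 4B) = ±2⁸pᵏ` and `p ∣ A² − 3B` (the `2`-torsion normal form `y² = x³ + Ax² + Bx` of the
integral model, `ξ = 4x₀ ∈ ℤ`, `A = b₂ + 3ξ`, `B = 3ξ² + 2b₂ξ + 8b₄`; `ξ` odd gives the first case,
`4 ∣ ξ` the second). [cite: Ivorra2004, §2.1 (2-adic normalisation of the models with a 2-torsion point); SilvermanAEC2009, III.1 Table 3.1] -/
theorem ramified_or_typeI (W : WeierstrassCurve ℚ) [W.IsElliptic] [W.IsGloballyMinimal] {p : ℕ}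
    (hp : p.Prime) (hp2 : p ≠ 2) (hN : W.conductorNorm ℤ = p ^ 2) {x₀ : ℚ}
    (hx₀ : HasRationalTwoTorsionX W x₀) :
    TwoTorsionRamifiedAtTwo x₀ ∨
      ∃ (A B : ℤ) (k : ℕ), 1 ≤ k ∧
        (B ^ 2 * (A ^ 2 - 4 * B) = 2 ^ 8 * (p : ℤ) ^ k ∨
          B ^ 2 * (A ^ 2 - 4 * B) = -(2 ^ 8 * (p : ℤ) ^ k)) ∧
        (p : ℤ) ∣ A ^ 2 - 3 * B ∧ A % 4 = 1 ∧ (8 : ℤ) ∣ B := by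
  -- the integral globally minimal model `W₀`, `W₀ ⊗ ℚ = W`
  set W₀ : WeierstrassCurve ℤ := integralModelInt W with hW₀def
  have hW₀ : W₀.baseChange ℚ = W := baseChange_integralModelInt W
  haveI hell : (W₀.baseChange ℚ).IsElliptic := by rw [hW₀]; infer_instance
  have hmin : ∀ v : HeightOneSpectrum ℤ, (W₀.baseChange ℚ).IsMinimalAt v := fun v ↦ by
    rw [hW₀]; exact IsGloballyMinimal.isMinimalAt_int W v
  have hN' : (W₀.baseChange ℚ).conductorNorm ℤ = p ^ 2 := by rw [hW₀]; exact hN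
  obtain ⟨k, hk1, hΔ, hc4⟩ := localData_of_conductorNorm_eq_sq W₀ hmin hp hN'
  -- the `2`-torsion point on `W₀ ⊗ ℚ`
  rw [← hW₀] at hx₀
  obtain ⟨y₀, heq, h2⟩ := hx₀
  have hb₂ : (W₀.baseChange ℚ).b₂ = (W₀.b₂ : ℚ) := by simp [WeierstrassCurve.baseChange]
  have hb₄ : (W₀.baseChange ℚ).b₄ = (W₀.b₄ : ℚ) := by simp [WeierstrassCurve.baseChange]
  have hb₆ : (W₀.baseChange ℚ).b₆ = (W₀.b₆ : ℚ) := by simp [WeierstrassCurve.baseChange]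
  -- `ξ = 4x₀ ∈ ℤ` is a root of the cubic (adapted from `exists_normalForm_of_prime_conductorNorm`)
  have hcubic := cubic_eq_zero (W₀.baseChange ℚ) heq h2
  rw [hb₂, hb₄, hb₆] at hcubic
  obtain ⟨ξ, hξ⟩ := exists_int_eq_of_cubic W₀ hcubic
  have hcubicZ : ξ ^ 3 + W₀.b₂ * ξ ^ 2 + 8 * W₀.b₄ * ξ + 16 * W₀.b₆ = 0 := by
    have : ((ξ ^ 3 + W₀.b₂ * ξ ^ 2 + 8 * W₀.b₄ * ξ + 16 * W₀.b₆ : ℤ) : ℚ) = 0 := by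
      push_cast; rw [hξ]; exact hcubic
    exact_mod_cast this
  -- the model `⟨0, A, 0, B, 0⟩`
  set A : ℤ := W₀.b₂ + 3 * ξ with hA
  set B : ℤ := 3 * ξ ^ 2 + 2 * W₀.b₂ * ξ + 8 * W₀.b₄ with hB
  set C₂ : VariableChange ℚ := ⟨⟨1 / 2, 2, by norm_num, by norm_num⟩, x₀, -(W₀.baseChange ℚ).a₁ / 2, y₀⟩
    with hC₂
  have hmodel : C₂ • (W₀.baseChange ℚ) = ⟨0, (A : ℚ), 0, (B : ℚ), 0⟩ := by
    rw [hC₂, smul_eq_twoTorsionModel (W₀.baseChange ℚ) heq h2, hb₂, hb₄, ← hξ, hA, hB]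
    push_cast
    ring_nf
  -- discriminant: `16 B²(A² − 4B) = 2¹² Δ(W₀)`
  have hΔmodel : (16 : ℚ) * (B : ℚ) ^ 2 * ((A : ℚ) ^ 2 - 4 * B) = 2 ^ 12 * (W₀.Δ : ℚ) := by
    have h1 := congrArg WeierstrassCurve.Δ hmodel
    rw [variableChange_Δ, Δ_twoTorsionModel, baseChange_int_Δ] at h1
    have hu : (((⟨1 / 2, 2, by norm_num, by norm_num⟩ : ℚˣ)⁻¹ : ℚˣ) : ℚ) = 2 := rfl
    rw [hC₂] at h1
    simp only [hu] at h1
    linear_combination -h1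
  have hdisc : B ^ 2 * (A ^ 2 - 4 * B) = 2 ^ 8 * W₀.Δ := by
    have : ((B ^ 2 * (A ^ 2 - 4 * B) : ℤ) : ℚ) = ((2 ^ 8 * W₀.Δ : ℤ) : ℚ) := by
      push_cast; linear_combination hΔmodel / 16
    exact_mod_cast this
  -- `A² − 3B = c₄`, divisible by `p`
  have hc4' : (p : ℤ) ∣ A ^ 2 - 3 * B := by rw [hA, hB, sq_sub_three_mul_eq_c₄]; exact hc4
  -- `a₁` is odd (`Δ = ±pᵏ` is odd; the supersingular case `a₁` even, `a₃` odd has no `2`-torsion)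
  have hpodd : Odd (p : ℤ) := by exact_mod_cast hp.odd_of_ne_two hp2
  have hΔodd : Odd W₀.Δ := by
    rcases hΔ with h | h <;> rw [h]
    · exact hpodd.pow
    · exact hpodd.pow.neg
  have ha₁odd : Odd W₀.a₁ := by
    rcases odd_a₁_or_odd_a₃_of_odd_Δ W₀ hΔodd with h | h
    · exact h
    · by_contra hev
      rw [Int.not_odd_iff_even] at hev
      exact no_root_of_even_a₁_odd_a₃ W₀ hev h ξ hcubicZ
  obtain ⟨e, he⟩ := b₂_eq_of_odd_a₁ W₀ ha₁odd
  have hb₂odd : Odd W₀.b₂ := ⟨4 * e + 2 * W₀.a₂, by rw [he]; ring⟩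
  rcases odd_or_four_dvd W₀.b₂ W₀.b₄ W₀.b₆ ξ hb₂odd hcubicZ with ⟨hξodd, -⟩ | h4
  · -- `ξ` odd: `x₀ = ξ/4` has `v₂(x₀) = −2`
    left
    have hξ0 : (ξ : ℚ) ≠ 0 := by
      have : ξ ≠ 0 := by rintro rfl; exact absurd hξodd (by decide)
      exact_mod_cast this
    have hx : x₀ = (ξ : ℚ) / 4 := by rw [hξ]; ring
    rw [twoTorsionRamifiedAtTwo_iff, hx, padicValRat.div hξ0 (by norm_num), padicValRat.of_int,
      padicValInt.eq_zero_of_not_dvd (by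
        have := Int.not_even_iff_odd.mpr hξodd
        rwa [even_iff_two_dvd] at this),
      show (4 : ℚ) = (2 : ℚ) ^ 2 by norm_num, padicValRat.pow]
    have h22 : padicValRat 2 (2 : ℚ) = 1 := by
      have := padicValRat.self (p := 2) one_lt_two
      simpa using this
    rw [h22]
    norm_num
  · -- `4 ∣ ξ`: type I
    right
    obtain ⟨hA4, hB8⟩ := typeI W₀.b₂ W₀.b₄ W₀.a₂ e ξ he h4
    refine ⟨A, B, k, hk1, ?_, hc4', hA4, hB8⟩
    rcases hΔ with h | h
    · left; rw [hdisc, h]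
    · right; rw [hdisc, h]; ring

end PrimeSq

/-! ## §3 The statements -/

/-- **Classification.** If an elliptic curve over `ℚ` of conductor `p²` (`p` an odd prime) has a rational
point of order `2` that is ÉTALE on the globally minimal model (`v₂(x₀) ≥ 0`, i.e. not in the kernel of
reduction mod `2`), then `p = 7`, `p = 17` or `p ≡ 1 (mod 8)` — the conductors `49`, `289` and
`(a² + 64)²`. [cite: Setzer1975, §2 (descent on the 2-torsion normal form; here at an additive prime)] -/
theorem star_primeSq_classify (W : WeierstrassCurve ℚ) [W.IsElliptic] [W.IsGloballyMinimal] {p : ℕ}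
    (hp : p.Prime) (hp2 : p ≠ 2) (hN : W.conductorNorm ℤ = p ^ 2) {x₀ : ℚ}
    (hx₀ : HasRationalTwoTorsionX W x₀) (het : ¬ TwoTorsionRamifiedAtTwo x₀) :
    p = 7 ∨ p = 17 ∨ p % 8 = 1 := by
  rcases PrimeSq.ramified_or_typeI W hp hp2 hN hx₀ with h | ⟨A, B, k, hk, hD, hC, hA, hB⟩
  · exact absurd h het
  · exact PrimeSq.typeI_classify hp hp2 hk hD hC hA hB

/-- **The prime-square edge of `StarGO2`** (planner bsd-rank2-p2 GEN 29 `PrimeSqEtaleTwoTorsion`, verbatim):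
an elliptic curve over `ℚ` of conductor `p²` with `p ≡ ±3 (mod 8)` has NO étale rational point of order `2`
— every rational `2`-torsion abscissa of a globally minimal model has negative `2`-adic valuation.
[cite: Setzer1975, §2; Ivorra2004, §2.1] -/
theorem star_primeSqEtaleTwoTorsion :
    ∀ (W : WeierstrassCurve ℚ) [W.IsElliptic] [W.IsGloballyMinimal] (p : ℕ), p.Prime →
      W.conductorNorm ℤ = p ^ 2 → (p % 8 = 3 ∨ p % 8 = 5) →
      ∀ x₀ : ℚ, HasRationalTwoTorsionX W x₀ → TwoTorsionRamifiedAtTwo x₀ := by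
  intro W _ _ p hp hN hp8 x₀ hx₀
  have hp2 : p ≠ 2 := by omega
  rcases PrimeSq.ramified_or_typeI W hp hp2 hN hx₀ with h | ⟨A, B, k, hk, hD, hC, hA, hB⟩
  · exact h
  · exact (PrimeSq.typeI_false hp hp8 hk hD hC hA hB).elim

end Summit.BirchSwinnertonDyer.BirchSwinnertonDyer.Theorems.DepletionAtTwo
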